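import Summits.BirchSwinnertonDyer.BirchSwinnertonDyer.Theorems.PrintCFramBottomClassIndexLawFiveLeEisensteinPairBernoulli
import Summits.BirchSwinnertonDyer.BirchSwinnertonDyer.Theorems.PrintCFramBottomClassIndexLawFiveLeBernoulliIntegralPrim
import Literature.NumberTheory.EllipticCurves.PAdicHeightsLogProofs
import HarnessLib

/-!
# Crux `PrintCFram.BottomClassIndexLawFiveLe` (stmt-BirchSwinnertonDyer-20372), line `eisenstein-resource-bdp-line` (registry v10):
# THE BERNOULLI UNITS OF THE KRIZ–LI DATUM, part I — `p`-INTEGRALITY of Kriz–Li's pair `b₁ = B_{1,ψ₀⁻¹ε_K}`, `b₂ = B_{1,ψ₀ω⁻¹}`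
# for the explicit class character, and TRANSFER of integrality / unit-ness along `ψ'↑ = ψ↑ ∨ ψ'↑ = ψ⁻¹↑·ω↑`
# (cell `bsd-print-cfram`, width seat `bsd-line-cfram-p1-w3` g4; THEOREMS ONLY, `--supports` 20372; BSD is not proved by any of this)

HONEST FRAMING. Nothing here is a statement about BSD; no stub of the skeleton is closed. This is the Bernoulli half of the
«Mazur–Wiles input packaging» of Stub H (`stub_bottomResidualSelmer_trivial_of_bernoulliPair`): the six-term table of the
herbrand M1 memo (§6) consumes, for the line characters `θ = ψ|`, `θ' = ψ⁻¹ω|` and their four lifts `ψ₀` (even), `ψ₀ε_K` (odd),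
`ψ₀⁻¹ω` (odd), `ψ₀⁻¹ωε_K` (even), exactly TWO Bernoulli numbers — Kriz–Li's `b₁ = B_{1,ψ₀⁻¹ε_K}` (tree:
`bernoulliOnePrim (bernoulliCharOne ψ εK)`) and `b₂ = B_{1,ψ₀ω⁻¹}` (`bernoulliOnePrim (bernoulliCharTwo ψ εK ω)`) — each as a
`p`-adic UNIT, whereas Kriz–Li's hypothesis (4) only says `¬ ‖b₁·b₂‖ ≤ p⁻¹`. The two statements are equivalent once BOTH numbers
are `p`-integral; integrality holds for w3 g2's explicit class character `ψ_c = χ↑·(ω^k)↑` (`m ⊥ p`, `2 ≤ k ≤ p − 2`) and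
TRANSFERS to every datum related to it by the uniqueness of the Eisenstein pair (w3 g3). Part II (`…BernoulliUnitsOfKrizLiClass`)
draws the END STATES on the class; part M (`…BernoulliUnitsMazurWilesCurrency`) supplies Mazur–Wiles' currency.

* §1 `p`-adic splitting: `‖x‖, ‖y‖ ≤ 1 ∧ ¬ ‖xy‖ ≤ p⁻¹ ⟹ ‖x‖ = ‖y‖ = 1`.
* §2 INTEGRALITY FROM ONE TEICHMÜLLER WITNESS: `‖bernoulliOnePrim χ‖ ≤ 1` as soon as `χ(u)·ω(u) ≠ 1` at one unit `u`
  (w3 g3's MASTER `BernoulliIntegral.norm_bernoulliOnePrim_le_one_of_unit` + `ω(u) ≡ u`).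
* §3 the class character `ψ_c = χ↑·(ω^k)↑`: `‖b₁(ψ_c)‖ ≤ 1` and, for `d ⊥ p`, `‖b₂(ψ_c)‖ ≤ 1` (Chinese-remainder witnesses
  `a ≡ 1 (mod m·d)`, `a ≡ g (mod p)`).
* §4 TRANSFER along `ψ₂↑ = ψ₁↑ ∨ ψ₂↑ = ψ₁⁻¹↑·ω↑` (the output shape of LEAD g8's T1 part 3
  `HerbrandLineCharacters.exists_dirichletCharacter_charSub_eq_or_eq_of_hss`): the product, integrality and unit-ness of the pair.

beyond-print theorem: NO (Washington §§4–5 integrality / Kriz–Li Cor. 8.4-type bookkeeping).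
References: [KrizLi2019] §1.5 (1), Thm. 1.20, §7.1, Cor. 8.4; [Washington1997] §4, §5.1, Cor. 5.15;
the herbrand M1 memo `Cruxes/BottomClassIndexLawFiveLe/Lines/herbrand-regular-locus-M1-anatomy.md` §§5–8.
-/

set_option autoImplicit false
set_option linter.dupNamespace false

noncomputable section

open scoped Classical
open DirichletCharacter Literature.NumberTheory.LFunctions Literature.NumberTheory.EllipticCurves.KrizLi2019
  Literature.NumberTheory.EllipticCurves Literature.NumberTheory.EllipticCurves.Rank1Residual

namespace Summit.BirchSwinnertonDyer.BirchSwinnertonDyer.Theorems.PrintCFram.BernoulliUnits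

open Summit.BirchSwinnertonDyer.BirchSwinnertonDyer.Theorems.PrintCFram

variable {p : ℕ} [hp : Fact p.Prime]

/-! ## §1 `p`-adic splitting of a unit product -/

/-- **Splitting.** If `x, y ∈ ℚ_p` are `p`-integral and `x·y` is NOT divisible by `p` (`¬ ‖xy‖ ≤ p⁻¹`), then both are units
(`‖t‖ < 1 ⟹ ‖t‖ ≤ p⁻¹`, tree `Literature.NumberTheory.EllipticCurves.norm_le_inv_of_norm_lt_one`). [cite: Gouvea1993PadicNumbers, §3.3] -/
theorem norm_eq_one_and_of_not_norm_mul_le {x y : ℚ_[p]} (hx : ‖x‖ ≤ 1) (hy : ‖y‖ ≤ 1)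
    (h : ¬ ‖x * y‖ ≤ (p : ℝ)⁻¹) : ‖x‖ = 1 ∧ ‖y‖ = 1 := by
  by_contra hne
  apply h
  rw [norm_mul]
  have h0 : (0 : ℝ) ≤ (p : ℝ)⁻¹ := by positivity
  rcases not_and_or.mp hne with hx1 | hy1
  · have hx' : ‖x‖ ≤ (p : ℝ)⁻¹ := norm_le_inv_of_norm_lt_one (lt_of_le_of_ne hx hx1)
    calc ‖x‖ * ‖y‖ ≤ (p : ℝ)⁻¹ * 1 := mul_le_mul hx' hy (norm_nonneg _) h0
      _ = (p : ℝ)⁻¹ := mul_one _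
  · have hy' : ‖y‖ ≤ (p : ℝ)⁻¹ := norm_le_inv_of_norm_lt_one (lt_of_le_of_ne hy hy1)
    calc ‖x‖ * ‖y‖ ≤ 1 * (p : ℝ)⁻¹ := mul_le_mul hx hy' (norm_nonneg _) zero_le_one
      _ = (p : ℝ)⁻¹ := one_mul _

/-! ## §2 Integrality of `bernoulliOnePrim χ` from ONE Teichmüller witness -/

/-- **Integrality from one Teichmüller witness.** Let `p` be odd, `p ∣ n`, `χ` a `ℚ_p`-valued character mod `n`, `ω` a
Teichmüller character mod `p`. If at ONE unit `u` of `ℤ/n` the root of unity `χ(u)·ω(u)` is `≠ 1` — i.e. the character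
`χ·ω↑` is non-trivial — then `‖bernoulliOnePrim χ‖_p ≤ 1`: indeed `χ(u)·u ≡ χ(u)·ω(u) ≢ 1 (mod p)`, the hypothesis of w3 g3's
MASTER statement. [cite: Washington1997, Thm. 4.2, §5.1, Cor. 5.15] [cite: KrizLi2019, §1.5 display (1) (p. 7)] -/
theorem norm_bernoulliOnePrim_le_one_of_apply_mul_teichmuller_ne_one (hp2 : p ≠ 2) {n : ℕ} [NeZero n] (hpn : p ∣ n)
    (χ : DirichletCharacter ℚ_[p] n) {ω : DirichletCharacter ℚ_[p] p} (hω : IsTeichmullerCharacter ω)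
    (u : (ZMod n)ˣ) (hu : χ (u : ZMod n) * ω ((((u : ZMod n).val : ℕ)) : ZMod p) ≠ 1) :
    ‖bernoulliOnePrim χ‖ ≤ 1 := by
  refine BernoulliIntegral.norm_bernoulliOnePrim_le_one_of_unit hp2 χ u ?_
  -- the character `η = χ · ω↑` and its value at `u`
  set η : DirichletCharacter ℚ_[p] n := χ * changeLevel hpn ω with hη
  have hηu : η (u : ZMod n) = χ (u : ZMod n) * ω ((((u : ZMod n).val : ℕ)) : ZMod p) := by
    rw [hη, MulChar.mul_apply, changeLevel_eq_cast_of_dvd, ZMod.cast_eq_val]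
  have hne : η (u : ZMod n) ≠ 1 := by rw [hηu]; exact hu
  have h1 : ‖η (u : ZMod n) - 1‖ = 1 := BernoulliIntegral.norm_apply_sub_one_eq_one hp2 η u hne
  -- `ω(u) ≡ u (mod p)`
  have hpu : ¬ ((p : ℤ) ∣ (((u : ZMod n).val : ℕ) : ℤ)) := by
    intro hd
    have hd' : p ∣ (u : ZMod n).val := by exact_mod_cast hd
    have hcop : Nat.Coprime (u : ZMod n).val n := ZMod.val_coe_unit_coprime u
    have : p ∣ 1 := by
      have := Nat.Coprime.coprime_dvd_right hpn hcop
      exact (Nat.Coprime.eq_one_of_dvd (Nat.Coprime.symm this) hd') ▸ dvd_rfl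
    exact hp.out.one_lt.ne' (Nat.dvd_one.mp this)
  have hT : ‖ω ((((u : ZMod n).val : ℕ)) : ZMod p) - ((((u : ZMod n).val : ℕ)) : ℚ_[p])‖ < 1 := by
    have := hω _ hpu
    push_cast at this
    exact this
  have hlt : ‖χ (u : ZMod n) * (((((u : ZMod n).val : ℕ)) : ℚ_[p]) - ω ((((u : ZMod n).val : ℕ)) : ZMod p))‖ < 1 := by
    rw [norm_mul]
    calc ‖χ (u : ZMod n)‖ * _ ≤ 1 * _ :=
          mul_le_mul_of_nonneg_right (BernoulliIntegral.norm_apply_le_one χ _) (norm_nonneg _)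
      _ < 1 := by rw [one_mul, norm_sub_rev]; exact hT
  have e : χ (u : ZMod n) * ((((u : ZMod n).val : ℕ)) : ℚ_[p]) - 1 =
      (η (u : ZMod n) - 1) +
        χ (u : ZMod n) * (((((u : ZMod n).val : ℕ)) : ℚ_[p]) - ω ((((u : ZMod n).val : ℕ)) : ZMod p)) := by
    rw [hηu]; ring
  rw [e]
  have hne' : ‖η (u : ZMod n) - 1‖ ≠
      ‖χ (u : ZMod n) * (((((u : ZMod n).val : ℕ)) : ℚ_[p]) - ω ((((u : ZMod n).val : ℕ)) : ZMod p))‖ := by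
    rw [h1]; exact (ne_of_lt hlt).symm
  rw [Padic.add_eq_max_of_ne hne', h1, max_eq_left hlt.le]

/-- **Integrality from one witness, any level.** For `χ` mod `n` (any `n`), `ω` Teichmüller, `p` odd: one unit `u` of `ℤ/(n·p)`
with `χ(u)·ω(u) ≠ 1` gives `‖bernoulliOnePrim χ‖_p ≤ 1` (lift `χ` to level `n·p`, where `bernoulliOnePrim` is unchanged).
[cite: Washington1997, Thm. 4.2, §5.1, Cor. 5.15] -/
theorem norm_bernoulliOnePrim_le_one_of_witness (hp2 : p ≠ 2) {n : ℕ} [NeZero n]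
    (χ : DirichletCharacter ℚ_[p] n) {ω : DirichletCharacter ℚ_[p] p} (hω : IsTeichmullerCharacter ω)
    (u : (ZMod (n * p))ˣ)
    (hu : χ ((((u : ZMod (n * p)).val : ℕ)) : ZMod n) * ω ((((u : ZMod (n * p)).val : ℕ)) : ZMod p) ≠ 1) :
    ‖bernoulliOnePrim χ‖ ≤ 1 := by
  haveI : NeZero (n * p) := ⟨Nat.mul_ne_zero (NeZero.ne n) hp.out.ne_zero⟩
  rw [← RegularLocusBernoulliPair.bernoulliOnePrim_changeLevel (dvd_mul_right n p) χ]
  refine norm_bernoulliOnePrim_le_one_of_apply_mul_teichmuller_ne_one hp2 (dvd_mul_left p n) _ hω u ?_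
  rwa [changeLevel_eq_cast_of_dvd, ZMod.cast_eq_val]

/-! ## §3 The explicit class character `ψ_c = χ↑·(ω^k)↑`: both Kriz–Li numbers are `p`-integral -/

section ClassCharacter

/-- **Chinese-remainder witness.** For `m, d` coprime to `p` and a unit `g` mod `p` there is a natural number `a` with
`a ≡ 1 (mod m)`, `a ≡ 1 (mod d)`, `a ≡ g (mod p)`, coprime to `m`, `d` and `p`. [folklore] -/
theorem exists_crt_witness {m d : ℕ} (hmp : m.Coprime p) (hdp : d.Coprime p) (g : (ZMod p)ˣ) :
    ∃ a : ℕ, a.Coprime m ∧ a.Coprime d ∧ a.Coprime p ∧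
      (a : ZMod m) = 1 ∧ (a : ZMod d) = 1 ∧ (a : ZMod p) = (g : ZMod p) := by
  have co : (m * d).Coprime p := Nat.Coprime.mul_left hmp hdp
  set t : ℕ := (g : ZMod p).val with ht
  obtain ⟨a, h1, h2⟩ := Nat.chineseRemainder co 1 t
  have hm1 : a ≡ 1 [MOD m] := h1.of_mul_right d
  have hd1 : a ≡ 1 [MOD d] := h1.of_mul_left m
  refine ⟨a, ?_, ?_, ?_, ?_, ?_, ?_⟩
  · rw [Nat.Coprime, Nat.ModEq.gcd_eq hm1, Nat.gcd_one_left]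
  · rw [Nat.Coprime, Nat.ModEq.gcd_eq hd1, Nat.gcd_one_left]
  · rw [Nat.Coprime, Nat.ModEq.gcd_eq h2, ht]
    exact ZMod.val_coe_unit_coprime g
  · rw [(ZMod.natCast_eq_natCast_iff' a 1 m).mpr hm1, Nat.cast_one]
  · rw [(ZMod.natCast_eq_natCast_iff' a 1 d).mpr hd1, Nat.cast_one]
  · rw [(ZMod.natCast_eq_natCast_iff' a t p).mpr h2, ht, ZMod.natCast_zmod_val]

/-- The reduction mod `p` of the least residue mod `n` (`p ∣ n`) of a natural number `a` is `a` mod `p`. [folklore] -/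
theorem natCast_val_natCast_of_dvd {n : ℕ} [NeZero n] (hpn : p ∣ n) (a : ℕ) :
    ((((a : ZMod n).val : ℕ)) : ZMod p) = (a : ZMod p) := by
  rw [ZMod.val_natCast, ZMod.natCast_eq_natCast_iff', Nat.mod_mod_of_dvd a hpn]

/-- A non-trivial power `ω^j` (`0 < j < p − 1`) of a Teichmüller character is `≠ 1` at SOME unit `g` mod `p`.
[cite: Washington1997, §5.1 (ω generates the character group of (ℤ/p)ˣ)] -/
theorem exists_unit_teichmuller_pow_ne_one {ω : DirichletCharacter ℚ_[p] p} (hω : IsTeichmullerCharacter ω) {j : ℕ}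
    (hj0 : 0 < j) (hj : j < p - 1) : ∃ g : (ZMod p)ˣ, ω (g : ZMod p) ^ j ≠ 1 := by
  obtain ⟨g, hg⟩ := MulChar.ne_one_iff.mp (KrizLiBinders.teichmuller_pow_ne_one hω hj0 hj)
  exact ⟨g, by rwa [MulChar.pow_apply_coe] at hg⟩

variable {m : ℕ} [hm : NeZero m]

omit hm in
/-- Value of the class character `ψ_c = χ↑·(ω^k)↑` at a natural number `a ≡ 1 (mod m)` coprime to `p·m`: `ψ_c(a) = ω(a)^k`.
[cite: KrizLi2019, §2 (p. 11, conventions on characters)] -/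
theorem classCharacter_apply_of_modEq_one (χ : DirichletCharacter ℚ_[p] m) {k : ℕ} (hk0 : k ≠ 0)
    (ω : DirichletCharacter ℚ_[p] p) {a : ℕ} (ha : a.Coprime (p * m)) (ha1 : (a : ZMod m) = 1) :
    (changeLevel (dvd_mul_left m p) χ * changeLevel (dvd_mul_right p m) (ω ^ k) :
        DirichletCharacter ℚ_[p] (p * m)) (a : ZMod (p * m)) = ω (a : ZMod p) ^ k := by
  rw [KrizLiBinders.psi_apply_natCast_of_coprime ω χ k hk0 ha, ha1, map_one, one_mul]

/-- **`‖b₁(ψ_c)‖_p ≤ 1`: the first Kriz–Li number of the (odd) class character `ψ_c = χ↑·(ω^k)↑` is `p`-integral** (`χ` mod `m`,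
`m ⊥ p`, `ω` Teichmüller, `2 ≤ k ≤ p − 2`, ANY `ε_K`): `b₁ = B_{1,ψ_c⁻¹}` and `ψ_c⁻¹·ω = χ⁻¹·ω^{1−k} ≠ 1` at the witness
`a ≡ 1 (mod m)`, `a ≡ g (mod p)` with `ω(g)^{k−1} ≠ 1`. [cite: KrizLi2019, Thm. 1.20 (p. 8) and Cor. 8.4] [cite: Washington1997, §5.1, Cor. 5.15] -/
theorem norm_bernoulliCharOne_classCharacter_le_one (hp2 : p ≠ 2) (χ : DirichletCharacter ℚ_[p] m) (hmp : m.Coprime p)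
    {k : ℕ} (hk2 : 2 ≤ k) (hkp : k ≤ p - 2) {ω : DirichletCharacter ℚ_[p] p} (hω : IsTeichmullerCharacter ω)
    (hodd : ¬ (changeLevel (dvd_mul_left m p) χ * changeLevel (dvd_mul_right p m) (ω ^ k) :
        DirichletCharacter ℚ_[p] (p * m)).Even)
    {d : ℕ} [NeZero d] (εK : DirichletCharacter ℚ_[p] d) :
    ‖bernoulliOnePrim (bernoulliCharOne (changeLevel (dvd_mul_left m p) χ * changeLevel (dvd_mul_right p m) (ω ^ k) :
        DirichletCharacter ℚ_[p] (p * m)) εK)‖ ≤ 1 := by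
  have hpp := hp.out
  haveI : NeZero (p * m) := ⟨Nat.mul_ne_zero hpp.ne_zero hm.out⟩
  set ψc : DirichletCharacter ℚ_[p] (p * m) :=
    changeLevel (dvd_mul_left m p) χ * changeLevel (dvd_mul_right p m) (ω ^ k) with hψc
  rw [RegularLocusBernoulliPair.bernoulliOnePrim_bernoulliCharOne_of_not_even ψc εK hodd]
  -- witness
  obtain ⟨g, hg⟩ := exists_unit_teichmuller_pow_ne_one hω (j := k - 1) (by omega) (by omega)
  obtain ⟨a, ham, -, hap, ha1, -, hag⟩ := exists_crt_witness hmp (Nat.coprime_one_left p) g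
  have hapm : a.Coprime (p * m) := Nat.Coprime.mul_right hap ham
  set u : (ZMod (p * m))ˣ := ZMod.unitOfCoprime a hapm with hu
  have huval : (u : ZMod (p * m)) = (a : ZMod (p * m)) := ZMod.coe_unitOfCoprime a hapm
  refine norm_bernoulliOnePrim_le_one_of_apply_mul_teichmuller_ne_one hp2 (dvd_mul_right p m) ψc⁻¹ hω u ?_
  rw [huval, natCast_val_natCast_of_dvd (dvd_mul_right p m), MulChar.inv_apply_eq_inv', hψc,
    classCharacter_apply_of_modEq_one χ (by omega) ω hapm ha1, hag]
  -- `(ω g ^ k)⁻¹ * ω g ≠ 1`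
  have hω0 : ω (g : ZMod p) ≠ 0 := fun h => by
    have h1 := EisensteinPair.norm_apply_coe_unit ω g
    rw [h, norm_zero] at h1
    exact zero_ne_one h1
  intro h
  apply hg
  have e : ω (g : ZMod p) ^ k = ω (g : ZMod p) ^ (k - 1) * ω (g : ZMod p) := by
    rw [← pow_succ, Nat.sub_add_cancel (by omega)]
  rw [e, mul_inv, mul_assoc, inv_mul_cancel₀ hω0, mul_one, inv_eq_one] at h
  exact h

/-- **`‖b₂(ψ_c)‖_p ≤ 1` when `p ∤ d`: the second Kriz–Li number of the class character is `p`-integral** (`χ` mod `m`, `m ⊥ p`,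
`ω` Teichmüller, `2 ≤ k ≤ p − 2`, `ε_K` mod `d` with `d ⊥ p` — at the Heegner field `p ∣ N_W` splits, so `p ∤ d_K`):
`b₂ = B_{1,ψ_c ε_K ω⁻¹}` and `(ψ_c ε_K ω⁻¹)·ω = ψ_c ε_K ≠ 1` at the witness `a ≡ 1 (mod m·d)`, `a ≡ g (mod p)` with `ω(g)^k ≠ 1`.
[cite: KrizLi2019, Thm. 1.20 (p. 8) and Cor. 8.4] [cite: Washington1997, §5.1, Cor. 5.15] -/
theorem norm_bernoulliCharTwo_classCharacter_le_one (hp2 : p ≠ 2) (χ : DirichletCharacter ℚ_[p] m) (hmp : m.Coprime p)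
    {k : ℕ} (hk2 : 2 ≤ k) (hkp : k ≤ p - 2) {ω : DirichletCharacter ℚ_[p] p} (hω : IsTeichmullerCharacter ω)
    (hodd : ¬ (changeLevel (dvd_mul_left m p) χ * changeLevel (dvd_mul_right p m) (ω ^ k) :
        DirichletCharacter ℚ_[p] (p * m)).Even)
    {d : ℕ} [NeZero d] (εK : DirichletCharacter ℚ_[p] d) (hdp : d.Coprime p) :
    ‖bernoulliOnePrim (bernoulliCharTwo (changeLevel (dvd_mul_left m p) χ * changeLevel (dvd_mul_right p m) (ω ^ k) :
        DirichletCharacter ℚ_[p] (p * m)) εK ω)‖ ≤ 1 := by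
  have hpp := hp.out
  haveI : NeZero (p * m) := ⟨Nat.mul_ne_zero hpp.ne_zero hm.out⟩
  set ψc : DirichletCharacter ℚ_[p] (p * m) :=
    changeLevel (dvd_mul_left m p) χ * changeLevel (dvd_mul_right p m) (ω ^ k) with hψc
  rw [RegularLocusBernoulliPair.bernoulliCharTwo_of_not_even ψc εK ω hodd]
  -- witness
  obtain ⟨g, hg⟩ := exists_unit_teichmuller_pow_ne_one hω (j := k) (by omega) (by omega)
  obtain ⟨a, ham, had, hap, ha1, hd1, hag⟩ := exists_crt_witness hmp hdp g
  have hapm : a.Coprime (p * m) := Nat.Coprime.mul_right hap ham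
  have hL : a.Coprime (p * m * d * p) := Nat.Coprime.mul_right (Nat.Coprime.mul_right hapm had) hap
  have hL' : a.Coprime (p * m * d) := Nat.Coprime.mul_right hapm had
  set u : (ZMod (p * m * d * p))ˣ := ZMod.unitOfCoprime a hL with hu
  have huval : (u : ZMod (p * m * d * p)) = ((a : ℤ) : ZMod (p * m * d * p)) := by
    rw [hu, ZMod.coe_unitOfCoprime, Int.cast_natCast]
  refine norm_bernoulliOnePrim_le_one_of_apply_mul_teichmuller_ne_one hp2 (dvd_mul_left p (p * m * d)) _ hω u ?_
  have hcZ : IsCoprime (a : ℤ) ((p * m * d * p : ℕ) : ℤ) := Nat.isCoprime_iff_coprime.mpr hL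
  have hcZ' : IsCoprime (a : ℤ) ((p * m * d : ℕ) : ℤ) := Nat.isCoprime_iff_coprime.mpr hL'
  have hval : ((((u : ZMod (p * m * d * p)).val : ℕ)) : ZMod p) = (g : ZMod p) := by
    rw [hu, ZMod.coe_unitOfCoprime, natCast_val_natCast_of_dvd (dvd_mul_left p (p * m * d)), hag]
  rw [hval, huval, MulChar.mul_apply, changeLevel_eq_cast_of_dvd' _ _ hcZ, changeLevel_eq_cast_of_dvd' _ _ hcZ,
    MulChar.mul_apply, changeLevel_eq_cast_of_dvd' _ _ hcZ', changeLevel_eq_cast_of_dvd' _ _ hcZ', Int.cast_natCast,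
    Int.cast_natCast, Int.cast_natCast, hψc, classCharacter_apply_of_modEq_one χ (by omega) ω hapm ha1, hd1, map_one,
    mul_one, hag, MulChar.inv_apply_eq_inv']
  have hω0 : ω (g : ZMod p) ≠ 0 := fun h => by
    have h1 := EisensteinPair.norm_apply_coe_unit ω g
    rw [h, norm_zero] at h1
    exact zero_ne_one h1
  rw [mul_assoc, inv_mul_cancel₀ hω0, mul_one]
  exact hg

end ClassCharacter

/-! ## §4 TRANSFER along `ψ₂↑ = ψ₁↑ ∨ ψ₂↑ = ψ₁⁻¹↑·ω↑` (uniqueness of the Eisenstein pair; LEAD g8's T1 output shape) -/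

section Transfer

variable {f₁ f₂ d M : ℕ}

/-- **The product `b₁b₂` is the same** for two character data related by `ψ₂↑ = ψ₁↑ ∨ ψ₂↑ = ψ₁⁻¹↑·ω↑` (`ω` odd).
[cite: KrizLi2019, Thm. 1.20 (p. 8) and §7.1 (p. 43)] -/
theorem bernoulliPair_prod_eq_of_eq_or_eq [NeZero f₁] [NeZero f₂] [NeZero d] [NeZero M]
    (h₁ : f₁ ∣ M) (h₂ : f₂ ∣ M) (hpM : p ∣ M)
    (ψ₁ : DirichletCharacter ℚ_[p] f₁) (ψ₂ : DirichletCharacter ℚ_[p] f₂)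
    (εK : DirichletCharacter ℚ_[p] d) (ω : DirichletCharacter ℚ_[p] p) (hω : ω.Odd)
    (e : changeLevel h₂ ψ₂ = changeLevel h₁ ψ₁ ∨ changeLevel h₂ ψ₂ = changeLevel h₁ ψ₁⁻¹ * changeLevel hpM ω) :
    bernoulliOnePrim (bernoulliCharOne ψ₂ εK) * bernoulliOnePrim (bernoulliCharTwo ψ₂ εK ω) =
      bernoulliOnePrim (bernoulliCharOne ψ₁ εK) * bernoulliOnePrim (bernoulliCharTwo ψ₁ εK ω) := by
  rcases e with e | e
  · obtain ⟨e1, e2⟩ := EisensteinPair.bernoulliOnePrim_pair_eq_of_eq h₁ h₂ ψ₁ ψ₂ εK ω e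
    rw [e1, e2]
  · obtain ⟨e1, e2⟩ := EisensteinPair.bernoulliOnePrim_pair_swap_of_eq h₁ h₂ hpM ψ₁ ψ₂ εK ω hω e
    rw [e1, e2, mul_comm]

/-- **Integrality of the pair transfers** (the SET `{b₁, b₂}` is the same). [cite: KrizLi2019, Thm. 1.20 (p. 8) and §7.1 (p. 43)] -/
theorem norm_pair_le_one_iff_of_eq_or_eq [NeZero f₁] [NeZero f₂] [NeZero d] [NeZero M]
    (h₁ : f₁ ∣ M) (h₂ : f₂ ∣ M) (hpM : p ∣ M)
    (ψ₁ : DirichletCharacter ℚ_[p] f₁) (ψ₂ : DirichletCharacter ℚ_[p] f₂)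
    (εK : DirichletCharacter ℚ_[p] d) (ω : DirichletCharacter ℚ_[p] p) (hω : ω.Odd)
    (e : changeLevel h₂ ψ₂ = changeLevel h₁ ψ₁ ∨ changeLevel h₂ ψ₂ = changeLevel h₁ ψ₁⁻¹ * changeLevel hpM ω) :
    (‖bernoulliOnePrim (bernoulliCharOne ψ₂ εK)‖ ≤ 1 ∧ ‖bernoulliOnePrim (bernoulliCharTwo ψ₂ εK ω)‖ ≤ 1) ↔
      (‖bernoulliOnePrim (bernoulliCharOne ψ₁ εK)‖ ≤ 1 ∧ ‖bernoulliOnePrim (bernoulliCharTwo ψ₁ εK ω)‖ ≤ 1) := by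
  rcases e with e | e
  · obtain ⟨e1, e2⟩ := EisensteinPair.bernoulliOnePrim_pair_eq_of_eq h₁ h₂ ψ₁ ψ₂ εK ω e
    rw [e1, e2]
  · obtain ⟨e1, e2⟩ := EisensteinPair.bernoulliOnePrim_pair_swap_of_eq h₁ h₂ hpM ψ₁ ψ₂ εK ω hω e
    rw [e1, e2]; exact and_comm

/-- **Unit-ness of the pair transfers** (the SET `{b₁, b₂}` is the same). [cite: KrizLi2019, Thm. 1.20 (p. 8) and §7.1 (p. 43)] -/
theorem norm_pair_eq_one_iff_of_eq_or_eq [NeZero f₁] [NeZero f₂] [NeZero d] [NeZero M]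
    (h₁ : f₁ ∣ M) (h₂ : f₂ ∣ M) (hpM : p ∣ M)
    (ψ₁ : DirichletCharacter ℚ_[p] f₁) (ψ₂ : DirichletCharacter ℚ_[p] f₂)
    (εK : DirichletCharacter ℚ_[p] d) (ω : DirichletCharacter ℚ_[p] p) (hω : ω.Odd)
    (e : changeLevel h₂ ψ₂ = changeLevel h₁ ψ₁ ∨ changeLevel h₂ ψ₂ = changeLevel h₁ ψ₁⁻¹ * changeLevel hpM ω) :
    (‖bernoulliOnePrim (bernoulliCharOne ψ₂ εK)‖ = 1 ∧ ‖bernoulliOnePrim (bernoulliCharTwo ψ₂ εK ω)‖ = 1) ↔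
      (‖bernoulliOnePrim (bernoulliCharOne ψ₁ εK)‖ = 1 ∧ ‖bernoulliOnePrim (bernoulliCharTwo ψ₁ εK ω)‖ = 1) := by
  rcases e with e | e
  · obtain ⟨e1, e2⟩ := EisensteinPair.bernoulliOnePrim_pair_eq_of_eq h₁ h₂ ψ₁ ψ₂ εK ω e
    rw [e1, e2]
  · obtain ⟨e1, e2⟩ := EisensteinPair.bernoulliOnePrim_pair_swap_of_eq h₁ h₂ hpM ψ₁ ψ₂ εK ω hω e
    rw [e1, e2]; exact and_comm

/-- **(4) + integrality for ONE datum ⟹ BOTH numbers are units for every related datum.**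
[cite: KrizLi2019, Thm. 1.20 (p. 8) and §7.1 (p. 43)] -/
theorem norm_pair_eq_one_of_eq_or_eq [NeZero f₁] [NeZero f₂] [NeZero d] [NeZero M]
    (h₁ : f₁ ∣ M) (h₂ : f₂ ∣ M) (hpM : p ∣ M)
    (ψ₁ : DirichletCharacter ℚ_[p] f₁) (ψ₂ : DirichletCharacter ℚ_[p] f₂)
    (εK : DirichletCharacter ℚ_[p] d) (ω : DirichletCharacter ℚ_[p] p) (hω : ω.Odd)
    (e : changeLevel h₂ ψ₂ = changeLevel h₁ ψ₁ ∨ changeLevel h₂ ψ₂ = changeLevel h₁ ψ₁⁻¹ * changeLevel hpM ω)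
    (h4 : ¬ ‖bernoulliOnePrim (bernoulliCharOne ψ₁ εK) * bernoulliOnePrim (bernoulliCharTwo ψ₁ εK ω)‖ ≤ (p : ℝ)⁻¹)
    (hb : ‖bernoulliOnePrim (bernoulliCharOne ψ₁ εK)‖ ≤ 1 ∧ ‖bernoulliOnePrim (bernoulliCharTwo ψ₁ εK ω)‖ ≤ 1) :
    ‖bernoulliOnePrim (bernoulliCharOne ψ₂ εK)‖ = 1 ∧ ‖bernoulliOnePrim (bernoulliCharTwo ψ₂ εK ω)‖ = 1 := by
  have hb2 := (norm_pair_le_one_iff_of_eq_or_eq h₁ h₂ hpM ψ₁ ψ₂ εK ω hω e).mpr hb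
  have h4' : ¬ ‖bernoulliOnePrim (bernoulliCharOne ψ₂ εK) * bernoulliOnePrim (bernoulliCharTwo ψ₂ εK ω)‖ ≤ (p : ℝ)⁻¹ := by
    rwa [bernoulliPair_prod_eq_of_eq_or_eq h₁ h₂ hpM ψ₁ ψ₂ εK ω hω e]
  exact norm_eq_one_and_of_not_norm_mul_le hb2.1 hb2.2 h4'

end Transfer

end Summit.BirchSwinnertonDyer.BirchSwinnertonDyer.Theorems.PrintCFram.BernoulliUnits

end
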